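import Literature.AlgebraicGeometry.Limits.LocalizationOpenDescent
import Literature.AlgebraicGeometry.Limits.SliceBaseChange
import Literature.AlgebraicGeometry.Limits.GrpTransfer
import Literature.AlgebraicGeometry.Limits.SeparatedSchematicExt
import Mathlib.AlgebraicGeometry.Morphisms.Flat
import HarnessLib

/-!
# Limits of schemes: a group law on the generic base change descends to a finite stage (EGA IV₃ 8.8.2)

Topic: `Literature/AlgebraicGeometry/Limits`; sequel of `Limits/LocalizationProdLimit`
(`Spec A_S = lim_s Spec A[1/s]`, spreading out of morphisms, Stacks 01ZC) and
`Limits/SliceBaseChange`. Let `B = A_S` be a localization of the commutative ring `A`, `P → Spec A`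
quasi-compact, quasi-separated and locally of finite presentation, and suppose the base change
`P_B = P ×_A Spec B → Spec B` carries the structure of a group scheme over `B`. Then:

* `exists_grpSpread` — the three structure morphisms spread out: for some `s ∈ S` there are
  `A`-morphisms `(P ⊗ P) ⊗ Spec A[1/s] → P`, `Spec A[1/s] → P` (from `𝟙 ⊗ Spec A[1/s]`),
  `P ⊗ Spec A[1/s] → P` restricting over `Spec B` to the multiplication, unit and inverse of `P_B`
  (read as `A`-morphisms `(P ⊗ P) ⊗ Spec B → P`, … through the dictionary of
  `Limits/SliceBaseChange`) — Stacks 01ZC, `LocApprox.exists_whiskerLeft_comp_eq`; such data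
  restrict to smaller stages (`GrpSpread.restrict`);
* `GrpSpread.grpObj` — **if moreover `P_s = P ×_A Spec A[1/s] → Spec A[1/s]` is flat and
  separated and `Spec B → Spec A[1/s]` is schematically dominant (e.g. `A` a domain,
  `S ⊆ A ∖ {0}`), these morphisms form a group-scheme structure on `P_s` over `A[1/s]`** whose
  base change along `Spec B → Spec A[1/s]` is the given one: `GrpSpread.isMonHom_legFacObjIso_hom`,
  the canonical `(P_s)_B ≅ P_B` is an isomorphism of group schemes. The group axioms transfer
  because base change to `Spec B` is *injective* on morphisms from flat `A[1/s]`-schemes to the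
  separated `P_s` (`Limits/SeparatedSchematicExt`), packaged as `Limits/GrpTransfer`.

This is the group-scheme case of EGA IV₃ Thm. 8.8.2 / Stacks 01ZM–01ZC ("the category of schemes
of finite presentation over `lim Sᵢ` is the colimit of the categories over the `Sᵢ`", applied to
the diagrams expressing a group structure), in the form needed to spread out an abelian variety
over the fraction field of a Dedekind domain to a group scheme over a dense open subset
(Milne, *Abelian Varieties*, Rem. 20.9: "an open subset where the group structure extends";
Bosch–Lütkebohmert–Raynaud, *Néron Models*, proof of Thm. 1.4/3).

## References

* A. Grothendieck, EGA IV₃, Thm. 8.8.2 (Publ. Math. IHÉS 28, 1966). [EGAIV3]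
* The Stacks project, Tags 01ZC, 01ZM. [StacksProject]
* J. S. Milne, *Abelian Varieties*, in Cornell–Silverman (eds.), *Arithmetic Geometry* (1986),
  §20, Rem. 20.9 (p. 146). [Milne1986AbelianVarieties]
-/

noncomputable section

universe u

open CategoryTheory CategoryTheory.Limits AlgebraicGeometry MonoidalCategory
  CartesianMonoidalCategory MonObj
open Functor.LaxMonoidal Functor.OplaxMonoidal
open scoped CategoryTheory.Obj

namespace Literature.AlgebraicGeometry.Limits

namespace LocApprox

open Literature.AlgebraicGeometry.Motives (SchemeOver specOver)

set_option backward.isDefEq.respectTransparency false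

variable {A : Type u} [CommRing A] (S : Submonoid A) (B : Type u) [CommRing B] [Algebra A B]
  [IsLocalization S B] (P : SchemeOver A)

/-! ## The objects: `P_B`, the stages `P_s`, restriction to `Spec B` -/

/-- `P_B = P ×_A Spec B` as a `B`-scheme. [folklore] -/
abbrev limObj : Over (specOver A B).left := (Over.pullback (specOver A B).hom).obj P

/-- The stage `P_s = P ×_A Spec A[1/s]` as an `A[1/s]`-scheme. [folklore] -/
abbrev stageObj (s : Idx S) : Over ((baseDiagram S).obj s).left :=
  (Over.pullback ((baseDiagram S).obj s).hom).obj P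

/-- Restriction from `A[1/s]`-schemes to `B`-schemes: base change along the leg
`Spec B → Spec A[1/s]`. [folklore] -/
abbrev legPullback (s : Idx S) : Over ((baseDiagram S).obj s).left ⥤ Over (specOver A B).left :=
  Over.pullback (leg S B s).left

/-- `(Q_s)_B ≅ Q_B`: restriction of the stage of `Q` to `Spec B` is the base change of `Q` to
`Spec B` (`Limits/SliceBaseChange.pullbackFacObjIso` for `Spec B → Spec A[1/s] → Spec A`). [folklore] -/
abbrev legFacObjIso (s : Idx S) (Q : SchemeOver A) :
    (legPullback S B s).obj ((Over.pullback ((baseDiagram S).obj s).hom).obj Q) ≅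
      (Over.pullback (specOver A B).hom).obj Q :=
  pullbackFacObjIso ((baseDiagram S).obj s).hom (leg S B s).left (specOver A B).hom
    (Over.w (leg S B s)) Q

/-- The same as a (monoidal) natural isomorphism of functors `SchemeOver A ⥤ Over (Spec B)`. [folklore] -/
abbrev legFacIso (s : Idx S) :
    Over.pullback ((baseDiagram S).obj s).hom ⋙ legPullback S B s ≅
      Over.pullback (specOver A B).hom :=
  pullbackFacIso ((baseDiagram S).obj s).hom (leg S B s).left (specOver A B).hom
    (Over.w (leg S B s))

/-! ## Monoidality of `(Q_s)_B ≅ Q_B` in explicit form -/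

section Monoidal

variable (s : Idx S)

/-- The legs `Spec B → Spec A[1/s]` are quasi-compact (affine). [folklore] -/
instance quasiCompact_leg_left : QuasiCompact (leg S B s).left := by
  haveI : IsAffine (specOver A B).left := inferInstanceAs (IsAffine (Spec (CommRingCat.of B)))
  haveI : IsAffineHom (leg S B s).left := isAffineHom_of_isAffine _
  infer_instance

/-- Tensor compatibility of the natural isomorphism `(–)_s|_B ≅ (–)_B` (a natural transformation of
cartesian-monoidal functors is monoidal, Mathlib `NatTrans.IsMonoidal.of_cartesianMonoidalCategory`),
solved for the base change of `μ : Q_s ⊗ R_s ≅ (Q ⊗ R)_s`. [folklore] -/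
@[reassoc]
theorem map_μ_comp_legFacObjIso_hom (Q R : SchemeOver A) :
    (legPullback S B s).map
        (Functor.LaxMonoidal.μ (Over.pullback ((baseDiagram S).obj s).hom) Q R) ≫
      (legFacObjIso S B s (Q ⊗ R)).hom =
    Functor.OplaxMonoidal.δ (legPullback S B s)
        ((Over.pullback ((baseDiagram S).obj s).hom).obj Q)
        ((Over.pullback ((baseDiagram S).obj s).hom).obj R) ≫
      ((legFacObjIso S B s Q).hom ⊗ₘ (legFacObjIso S B s R).hom) ≫
        Functor.LaxMonoidal.μ (Over.pullback (specOver A B).hom) Q R := by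
  have e := NatTrans.IsMonoidal.tensor (τ := (legFacIso S B s).hom) Q R
  rw [Functor.LaxMonoidal.comp_μ, Category.assoc] at e
  rw [← cancel_epi (Functor.LaxMonoidal.μ (legPullback S B s)
    ((Over.pullback ((baseDiagram S).obj s).hom).obj Q)
    ((Over.pullback ((baseDiagram S).obj s).hom).obj R)), Functor.Monoidal.μ_δ_assoc]
  exact e

/-- Unit compatibility of `(–)_s|_B ≅ (–)_B`, solved for the base change of `ε : 𝟙 ≅ 𝟙_s`. [folklore] -/
@[reassoc]
theorem map_ε_comp_legFacObjIso_hom :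
    (legPullback S B s).map (Functor.LaxMonoidal.ε (Over.pullback ((baseDiagram S).obj s).hom)) ≫
      (legFacObjIso S B s (𝟙_ (SchemeOver A))).hom =
    Functor.OplaxMonoidal.η (legPullback S B s) ≫
      Functor.LaxMonoidal.ε (Over.pullback (specOver A B).hom) := by
  have e := NatTrans.IsMonoidal.unit (τ := (legFacIso S B s).hom)
  rw [Functor.LaxMonoidal.comp_ε, Category.assoc] at e
  rw [← cancel_epi (Functor.LaxMonoidal.ε (legPullback S B s)), Functor.Monoidal.ε_η_assoc]
  exact e

end Monoidal

/-! ## The structure maps of `P_B` as `A`-morphisms, and their spreadings -/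

section Ext

variable [GrpObj (limObj B P)]

/-- The multiplication of `P_B`, as an `A`-morphism `(P ⊗ P) ⊗ Spec B → P`. [folklore] -/
def mulExt : (P ⊗ P) ⊗ specOver A B ⟶ P :=
  unsliceHom (specOver A B)
    (Functor.OplaxMonoidal.δ (Over.pullback (specOver A B).hom) P P ≫ μ[limObj B P])

/-- The unit of `P_B`, as an `A`-morphism `𝟙 ⊗ Spec B → P`. [folklore] -/
def oneExt : 𝟙_ (SchemeOver A) ⊗ specOver A B ⟶ P :=
  unsliceHom (specOver A B)
    (Functor.OplaxMonoidal.η (Over.pullback (specOver A B).hom) ≫ η[limObj B P])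

/-- The inverse of `P_B`, as an `A`-morphism `P ⊗ Spec B → P`. [folklore] -/
def invExt : P ⊗ specOver A B ⟶ P :=
  unsliceHom (specOver A B) ι[limObj B P]

/-- `GrpSpread S B P s`: spreadings to the stage `Spec A[1/s]` of the multiplication, unit and
inverse of `P_B` — `A`-morphisms out of `(P ⊗ P) ⊗ Spec A[1/s]`, `𝟙 ⊗ Spec A[1/s]`,
`P ⊗ Spec A[1/s]` restricting over `Spec B` to `mulExt`, `oneExt`, `invExt`.
[cite: EGAIV3, Thm. 8.8.2 (i)] -/
structure GrpSpread (s : Idx S) where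
  /-- spreading of the multiplication -/
  gm : (P ⊗ P) ⊗ (baseDiagram S).obj s ⟶ P
  /-- spreading of the unit -/
  ge : 𝟙_ (SchemeOver A) ⊗ (baseDiagram S).obj s ⟶ P
  /-- spreading of the inverse -/
  gi : P ⊗ (baseDiagram S).obj s ⟶ P
  /-- `gm` restricts to the multiplication -/
  hm : ((P ⊗ P) ◁ leg S B s) ≫ gm = mulExt B P
  /-- `ge` restricts to the unit -/
  he : (𝟙_ (SchemeOver A) ◁ leg S B s) ≫ ge = oneExt B P
  /-- `gi` restricts to the inverse -/
  hi : (P ◁ leg S B s) ≫ gi = invExt B P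

variable {S B P}

/-- Spreadings restrict to smaller stages. [folklore] -/
def GrpSpread.restrict {t s : Idx S} (d : GrpSpread S B P s) (ρ : t ⟶ s) : GrpSpread S B P t where
  gm := ((P ⊗ P) ◁ (baseDiagram S).map ρ) ≫ d.gm
  ge := (𝟙_ (SchemeOver A) ◁ (baseDiagram S).map ρ) ≫ d.ge
  gi := (P ◁ (baseDiagram S).map ρ) ≫ d.gi
  hm := by rw [← MonoidalCategory.whiskerLeft_comp_assoc, leg_comp_map, d.hm]
  he := by rw [← MonoidalCategory.whiskerLeft_comp_assoc, leg_comp_map, d.he]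
  hi := by rw [← MonoidalCategory.whiskerLeft_comp_assoc, leg_comp_map, d.hi]

variable (S B P)

/-- **The structure maps of `P_B` spread out to a common stage** (`P` quasi-compact,
quasi-separated and locally of finite presentation over `A`): three applications of the
surjectivity half of Stacks 01ZC (`exists_whiskerLeft_comp_eq`) and a common refinement of the
three stages. [cite: StacksProject, Tag 01ZC] [cite: EGAIV3, Thm. 8.8.2 (i)] -/
theorem exists_grpSpread [QuasiCompact P.hom] [QuasiSeparated P.hom]
    [LocallyOfFinitePresentation P.hom] : ∃ s : Idx S, Nonempty (GrpSpread S B P s) := by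
  haveI : QuasiCompact (P ⊗ P).hom :=
    inferInstanceAs (QuasiCompact (pullback.fst P.hom P.hom ≫ P.hom))
  haveI : QuasiSeparated (P ⊗ P).hom :=
    inferInstanceAs (QuasiSeparated (pullback.fst P.hom P.hom ≫ P.hom))
  haveI : QuasiCompact (𝟙_ (SchemeOver A)).hom :=
    inferInstanceAs (QuasiCompact (𝟙 (Spec (CommRingCat.of A))))
  haveI : QuasiSeparated (𝟙_ (SchemeOver A)).hom :=
    inferInstanceAs (QuasiSeparated (𝟙 (Spec (CommRingCat.of A))))
  obtain ⟨s₁, g₁, h₁⟩ := exists_whiskerLeft_comp_eq B (S := S) (P := P ⊗ P) (mulExt B P)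
  obtain ⟨s₂, g₂, h₂⟩ :=
    exists_whiskerLeft_comp_eq B (S := S) (P := 𝟙_ (SchemeOver A)) (oneExt B P)
  obtain ⟨s₃, g₃, h₃⟩ := exists_whiskerLeft_comp_eq B (S := S) (P := P) (invExt B P)
  obtain ⟨r, ⟨ρ₁⟩, ⟨ρ₂⟩⟩ := exists_hom₂ S s₁ s₂
  obtain ⟨t, ⟨σ⟩, ⟨ρ₃⟩⟩ := exists_hom₂ S r s₃
  refine ⟨t, ⟨⟨((P ⊗ P) ◁ (baseDiagram S).map (σ ≫ ρ₁)) ≫ g₁,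
    (𝟙_ (SchemeOver A) ◁ (baseDiagram S).map (σ ≫ ρ₂)) ≫ g₂,
    (P ◁ (baseDiagram S).map ρ₃) ≫ g₃, ?_, ?_, ?_⟩⟩⟩
  · rw [← MonoidalCategory.whiskerLeft_comp_assoc, leg_comp_map, h₁]
  · rw [← MonoidalCategory.whiskerLeft_comp_assoc, leg_comp_map, h₂]
  · rw [← MonoidalCategory.whiskerLeft_comp_assoc, leg_comp_map, h₃]

end Ext

/-! ## The group structure on a flat separated stage -/

section Transfer

variable {S B P} {s : Idx S} [GrpObj (limObj B P)]

/-- The group structure on `(P_s)_B` transported from `P_B` along `(P_s)_B ≅ P_B`. [folklore] -/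
abbrev grpObjLegObj (s : Idx S) : GrpObj ((legPullback S B s).obj (stageObj S P s)) :=
  GrpObj.ofIso (legFacObjIso S B s P).symm

attribute [local instance] grpObjLegObj

/-- The candidate multiplication on the stage `P_s`: `P_s ⊗ P_s ≅ (P ⊗ P)_s → P_s`, the second map
being the `A[1/s]`-morphism attached to the spreading `gm : (P ⊗ P) ⊗ Spec A[1/s] → P`. [folklore] -/
def GrpSpread.mul (d : GrpSpread S B P s) : stageObj S P s ⊗ stageObj S P s ⟶ stageObj S P s :=
  Functor.LaxMonoidal.μ (Over.pullback ((baseDiagram S).obj s).hom) P P ≫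
    sliceHom ((baseDiagram S).obj s) d.gm

/-- The candidate unit on the stage `P_s`: `𝟙 ≅ 𝟙_s → P_s`. [folklore] -/
def GrpSpread.one (d : GrpSpread S B P s) :
    𝟙_ (Over ((baseDiagram S).obj s).left) ⟶ stageObj S P s :=
  Functor.LaxMonoidal.ε (Over.pullback ((baseDiagram S).obj s).hom) ≫
    sliceHom ((baseDiagram S).obj s) d.ge

/-- The candidate inverse on the stage `P_s`. [folklore] -/
def GrpSpread.inv (d : GrpSpread S B P s) : stageObj S P s ⟶ stageObj S P s :=
  sliceHom ((baseDiagram S).obj s) d.gi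

/-- Base change to `Spec B` of the `A[1/s]`-morphism attached to `gm`: it is the multiplication of
`P_B` (conjugated by `(P ⊗ P)_s|_B ≅ (P ⊗ P)_B`, `(P_s)_B ≅ P_B`), by `pullback_map_sliceHom` and
`hm`. [folklore] -/
theorem GrpSpread.map_sliceHom_gm (d : GrpSpread S B P s) :
    (legPullback S B s).map (sliceHom ((baseDiagram S).obj s) d.gm) =
      (legFacObjIso S B s (P ⊗ P)).hom ≫
        Functor.OplaxMonoidal.δ (Over.pullback (specOver A B).hom) P P ≫ μ[limObj B P] ≫
          (legFacObjIso S B s P).inv := by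
  have e := pullback_map_sliceHom (leg S B s) (P := P) d.gm
  rw [d.hm, mulExt, sliceHom_unsliceHom] at e
  simpa only [Category.assoc] using (Iso.eq_comp_inv _).mpr e

/-- Base change to `Spec B` of the `A[1/s]`-morphism attached to `ge`: the unit of `P_B`. [folklore] -/
theorem GrpSpread.map_sliceHom_ge (d : GrpSpread S B P s) :
    (legPullback S B s).map (sliceHom ((baseDiagram S).obj s) d.ge) =
      (legFacObjIso S B s (𝟙_ (SchemeOver A))).hom ≫
        Functor.OplaxMonoidal.η (Over.pullback (specOver A B).hom) ≫ η[limObj B P] ≫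
          (legFacObjIso S B s P).inv := by
  have e := pullback_map_sliceHom (leg S B s) (P := P) d.ge
  rw [d.he, oneExt, sliceHom_unsliceHom] at e
  simpa only [Category.assoc] using (Iso.eq_comp_inv _).mpr e

/-- Base change to `Spec B` of the `A[1/s]`-morphism attached to `gi`: the inverse of `P_B`. [folklore] -/
theorem GrpSpread.map_sliceHom_gi (d : GrpSpread S B P s) :
    (legPullback S B s).map (sliceHom ((baseDiagram S).obj s) d.gi) =
      (legFacObjIso S B s P).hom ≫ ι[limObj B P] ≫ (legFacObjIso S B s P).inv := by
  have e := pullback_map_sliceHom (leg S B s) (P := P) d.gi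
  rw [d.hi, invExt, sliceHom_unsliceHom] at e
  simpa only [Category.assoc] using (Iso.eq_comp_inv _).mpr e

/-- Restricted to `Spec B`, the candidate multiplication is the multiplication of `(P_s)_B`
(transported from `P_B`): the dictionary commutes with base change (`pullback_map_sliceHom`),
`gm` restricts to `mulExt`, and `(P_s)_B ≅ P_B` is monoidal (cartesian functors). [cite: EGAIV3, Thm. 8.8.2 (i)] -/
theorem GrpSpread.map_mul (d : GrpSpread S B P s) :
    (legPullback S B s).map d.mul =
      Functor.OplaxMonoidal.δ (legPullback S B s) (stageObj S P s) (stageObj S P s) ≫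
        μ[(legPullback S B s).obj (stageObj S P s)] := by
  rw [GrpSpread.mul, Functor.map_comp, d.map_sliceHom_gm, map_μ_comp_legFacObjIso_hom_assoc,
    Functor.Monoidal.μ_δ_assoc, MonObj.ofIso_mul]
  simp only [Iso.symm_inv, Iso.symm_hom]

/-- Restricted to `Spec B`, the candidate unit is the unit of `(P_s)_B`. [cite: EGAIV3, Thm. 8.8.2 (i)] -/
theorem GrpSpread.map_one (d : GrpSpread S B P s) :
    (legPullback S B s).map d.one =
      Functor.OplaxMonoidal.η (legPullback S B s) ≫ η[(legPullback S B s).obj (stageObj S P s)] := by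
  rw [GrpSpread.one, Functor.map_comp, d.map_sliceHom_ge, map_ε_comp_legFacObjIso_hom_assoc,
    Functor.Monoidal.ε_η_assoc, MonObj.ofIso_one]
  simp only [Iso.symm_hom]

/-- Restricted to `Spec B`, the candidate inverse is the inverse of `(P_s)_B`. [cite: EGAIV3, Thm. 8.8.2 (i)] -/
theorem GrpSpread.map_inv (d : GrpSpread S B P s) :
    (legPullback S B s).map d.inv = ι[(legPullback S B s).obj (stageObj S P s)] := by
  rw [GrpSpread.inv, d.map_sliceHom_gi, GrpObj.ofIso_inv]
  simp only [Iso.symm_inv, Iso.symm_hom]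

variable [Flat (stageObj S P s).hom] [IsSeparated (stageObj S P s).hom]
  [IsSchemeTheoreticallyDominant (leg S B s).left]

/-- **The lifted group data on a flat separated stage.** With `P_s → Spec A[1/s]` flat and
separated and `Spec B → Spec A[1/s]` schematically dominant, restriction to `Spec B` is injective on
morphisms `X → P_s` from flat `A[1/s]`-schemes `X` (`pullback_map_injective_of_flat`), and the
candidate structure maps lift those of `(P_s)_B`. [cite: EGAIV3, Thm. 8.8.2] -/
def GrpSpread.liftedGrpData (d : GrpSpread S B P s) :
    LiftedGrpData (legPullback S B s) (stageObj S P s) (fun X => Flat X.hom) where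
  injective X hX := by
    haveI : Flat X.hom := hX
    exact pullback_map_injective_of_flat (leg S B s).left
  tensor X Y hX hY := by
    haveI : Flat X.hom := hX
    haveI : Flat Y.hom := hY
    exact inferInstanceAs (Flat (pullback.fst X.hom Y.hom ≫ X.hom))
  unit := inferInstanceAs (Flat (𝟙 _))
  self := ‹_›
  one := d.one
  mul := d.mul
  inv := d.inv
  map_one := d.map_one
  map_mul := d.map_mul
  map_inv := d.map_inv

/-- **The group-scheme structure on the stage `P_s = P ×_A Spec A[1/s]`** descended from the
group structure on `P_B` (EGA IV₃ 8.8.2 for the diagrams of a group object): unit,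
multiplication and inverse are the spread-out structure maps, and the axioms hold because they
hold after the injective restriction to `Spec B`. [cite: EGAIV3, Thm. 8.8.2] [cite: StacksProject, Tag 01ZM] -/
abbrev GrpSpread.grpObj (d : GrpSpread S B P s) : GrpObj (stageObj S P s) :=
  d.liftedGrpData.grpObj

/-- **The base change of the descended group scheme `P_s` to `Spec B` is `P_B` as a group
scheme**: the canonical isomorphism `(P_s)_B ≅ P_B` is an isomorphism of group objects, for the
structure on `(P_s)_B` *induced by the monoidal base-change functor* from the descended structure
(`Functor.monObjObj`, stated explicitly to keep it apart from the transported structure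
`grpObjLegObj` used in the construction) and the given structure on `P_B`. [cite: EGAIV3, Thm. 8.8.2] -/
theorem GrpSpread.isMonHom_legFacObjIso_hom (d : GrpSpread S B P s) :
    letI : GrpObj (stageObj S P s) := d.grpObj
    @IsMonHom _ _ _ _ _ (Functor.monObjObj (F := legPullback S B s) (stageObj S P s))
      inferInstance (legFacObjIso S B s P).hom :=
  LiftedGrpData.isMonHom_hom (legFacObjIso S B s P) d.liftedGrpData

end Transfer

end LocApprox

end Literature.AlgebraicGeometry.Limits

end
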